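import Summits.Ventures.CertifiedQuantumChemistry.Certificates.HubbardRingL6LiftBlockDuu
import Summits.Ventures.CertifiedQuantumChemistry.Certificates.HubbardRingL6LiftBlockQuu
import Summits.Ventures.CertifiedQuantumChemistry.Certificates.HubbardRingL6LiftBlockDmixed
import Summits.Ventures.CertifiedQuantumChemistry.Certificates.HubbardRingL6LiftBlockQmixed
import Summits.Ventures.CertifiedQuantumChemistry.Certificates.HubbardRingL6LiftBlockDdd
import Summits.Ventures.CertifiedQuantumChemistry.Certificates.HubbardRingL6LiftBlockQdd
import Summits.Ventures.CertifiedQuantumChemistry.Rows.BlockScatterPSD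
import HarnessLib

/-!
# Ventures/CertifiedQuantumChemistry — Certificates/HubbardRingL6LiftPairPSD.lean: LAYER 1 (pair blocks) of the L = 6 lift assembly —
# the two-matrix `Γ(ε)` and the `Q`-matrix `Q(ε)` of the exact L = 6 lift family, on the 144 ordered-pair codes, DEFINED as signed
# scatter-sums of the landed pair-block tables, are positive semidefinite for `0 < ε ≤ 2⁻⁵¹`

HONEST FRAMING (verbatim): certified bounds for a stated model Hamiltonian in a stated basis; not a
claim about the real molecule beyond that model. Auxiliary objects (a polynomial family of relaxation variables of the half-filled Hubbard
6-ring's level-DQG programme); no model energy is bounded here.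

Seat rdm-B (gen 42; `tools/x14-g42/l6/MEMO-L6-KERNEL-FLOOR.md` §7). Unlike gen 41's L = 4 layer 1 (literal `64 × 64` pair tables + kernel
identities), the L = 6 coefficient matrices are DEFINED as the signed scatters (`Rows/BlockScatterPSD.lean` §3) of the block tables of
`Certificates/HubbardRingL6LiftBlock{Duu,Dmixed,Ddd,Quu,Qmixed,Qdd}.lean` (antisymmetric compression `uu 15 | mixed 36 | dd 15`; index
tables `l6LabP/l6PosP/l6SgnP` on the code `I = 12·x + y`, `x = 2p + σ`, by `tools/x14-g42/l6/mk_index_tables6.py`), so no identity is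
needed here; the layer-2 file will prove that `Q_j = qMapP(γ_j, Γ_j)` and the linear rows ENTRYWISE by kernel evaluation of these
(computable, rational) definitions. THE THEOREMS: **`l6realGG_posSemidef`**, **`l6realQQ_posSemidef`** — `Γ(ε), Q(ε) ⪰ 0` (real `144 × 144`)
for `0 < ε ≤ 2⁻⁵¹` (each block's `ε·(ρ₁+ρ₂) ≤ μ` follows from `ε ≤ 2⁻⁵¹` by `norm_num` on the blocks' constants). 0 sorry; standard axioms.
-/

set_option linter.style.longLine false

namespace Summit.Ventures.CertifiedQuantumChemistry

namespace LiftL6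

open Matrix Finset PencilRat BlockScatter

/-! ## §1 Index tables of the pair blocks (code `I = 12·x + y`) -/

/-- Pair-block label `σ_x + σ_y` (0 = ↑↑, 1 = mixed, 2 = ↓↓), as a `12 × 12` table. -/
def l6LabPT : Fin 12 → Fin 12 → ℕ :=
  ![![0, 1, 0, 1, 0, 1, 0, 1, 0, 1, 0, 1], ![1, 2, 1, 2, 1, 2, 1, 2, 1, 2, 1, 2], ![0, 1, 0, 1, 0, 1, 0, 1, 0, 1, 0, 1], ![1, 2, 1, 2, 1, 2, 1, 2, 1, 2, 1, 2], ![0, 1, 0, 1, 0, 1, 0, 1, 0, 1, 0, 1], ![1, 2, 1, 2, 1, 2, 1, 2, 1, 2, 1, 2], ![0, 1, 0, 1, 0, 1, 0, 1, 0, 1, 0, 1], ![1, 2, 1, 2, 1, 2, 1, 2, 1, 2, 1, 2], ![0, 1, 0, 1, 0, 1, 0, 1, 0, 1, 0, 1], ![1, 2, 1, 2, 1, 2, 1, 2, 1, 2, 1, 2], ![0, 1, 0, 1, 0, 1, 0, 1, 0, 1, 0, 1], ![1, 2, 1, 2, 1, 2, 1, 2, 1, 2, 1, 2]]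

/-- Position inside the compressed pair block, as a `12 × 12` table. -/
def l6PosPT : Fin 12 → Fin 12 → ℕ :=
  ![![0, 0, 0, 1, 1, 2, 2, 3, 3, 4, 4, 5], ![0, 0, 6, 0, 12, 1, 18, 2, 24, 3, 30, 4], ![0, 6, 0, 7, 5, 8, 6, 9, 7, 10, 8, 11], ![1, 0, 7, 0, 13, 5, 19, 6, 25, 7, 31, 8], ![1, 12, 5, 13, 0, 14, 9, 15, 10, 16, 11, 17], ![2, 1, 8, 5, 14, 0, 20, 9, 26, 10, 32, 11], ![2, 18, 6, 19, 9, 20, 0, 21, 12, 22, 13, 23], ![3, 2, 9, 6, 15, 9, 21, 0, 27, 12, 33, 13], ![3, 24, 7, 25, 10, 26, 12, 27, 0, 28, 14, 29], ![4, 3, 10, 7, 16, 10, 22, 12, 28, 0, 34, 14], ![4, 30, 8, 31, 11, 32, 13, 33, 14, 34, 0, 35], ![5, 4, 11, 8, 17, 11, 23, 13, 29, 14, 35, 0]]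

/-- Antisymmetry sign (`+1` representative orientation, `−1` reversed, `0` diagonal), as a `12 × 12` table. -/
def l6SgnPT : Fin 12 → Fin 12 → ℚ :=
  ![![0, 1, 1, 1, 1, 1, 1, 1, 1, 1, 1, 1], ![(-1 : ℚ), 0, (-1 : ℚ), 1, (-1 : ℚ), 1, (-1 : ℚ), 1, (-1 : ℚ), 1, (-1 : ℚ), 1], ![(-1 : ℚ), 1, 0, 1, 1, 1, 1, 1, 1, 1, 1, 1], ![(-1 : ℚ), (-1 : ℚ), (-1 : ℚ), 0, (-1 : ℚ), 1, (-1 : ℚ), 1, (-1 : ℚ), 1, (-1 : ℚ), 1], ![(-1 : ℚ), 1, (-1 : ℚ), 1, 0, 1, 1, 1, 1, 1, 1, 1], ![(-1 : ℚ), (-1 : ℚ), (-1 : ℚ), (-1 : ℚ), (-1 : ℚ), 0, (-1 : ℚ), 1, (-1 : ℚ), 1, (-1 : ℚ), 1], ![(-1 : ℚ), 1, (-1 : ℚ), 1, (-1 : ℚ), 1, 0, 1, 1, 1, 1, 1], ![(-1 : ℚ), (-1 : ℚ), (-1 : ℚ), (-1 : ℚ), (-1 : ℚ), (-1 : ℚ),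 (-1 : ℚ), 0, (-1 : ℚ), 1, (-1 : ℚ), 1], ![(-1 : ℚ), 1, (-1 : ℚ), 1, (-1 : ℚ), 1, (-1 : ℚ), 1, 0, 1, 1, 1], ![(-1 : ℚ), (-1 : ℚ), (-1 : ℚ), (-1 : ℚ), (-1 : ℚ), (-1 : ℚ), (-1 : ℚ), (-1 : ℚ), (-1 : ℚ), 0, (-1 : ℚ), 1], ![(-1 : ℚ), 1, (-1 : ℚ), 1, (-1 : ℚ), 1, (-1 : ℚ), 1, (-1 : ℚ), 1, 0, 1], ![(-1 : ℚ), (-1 : ℚ), (-1 : ℚ), (-1 : ℚ), (-1 : ℚ), (-1 : ℚ), (-1 : ℚ), (-1 : ℚ), (-1 : ℚ), (-1 : ℚ), (-1 : ℚ), 0]]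

/-- Pair-block label of an ordered-pair code. -/
def l6LabP (I : Fin 144) : ℕ := l6LabPT ⟨I.val / 12, by omega⟩ ⟨I.val % 12, by omega⟩

/-- Position of an ordered-pair code inside its compressed pair block. -/
def l6PosP (I : Fin 144) : ℕ := l6PosPT ⟨I.val / 12, by omega⟩ ⟨I.val % 12, by omega⟩

/-- Antisymmetry sign of an ordered-pair code. -/
def l6SgnP (I : Fin 144) : ℚ := l6SgnPT ⟨I.val / 12, by omega⟩ ⟨I.val % 12, by omega⟩

/-- Pair-block sizes `15 | 36 | 15`. -/
def l6szP : ℕ → ℕ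
  | 1 => 36
  | _ => 15

/-! ## §2 The coefficient matrices `Γ_j`, `Q_j` as scatter-sums, and the real families -/

/-- The `Γ` pair-block coefficient tables by block number. -/
noncomputable def l6blkD : (b : ℕ) → Fin 3 → Fin (l6szP b) → Fin (l6szP b) → ℚ
  | 0 => l6DuuX
  | 1 => l6DmixedX
  | 2 => l6DddX
  | _ + 3 => fun _ _ _ => 0

/-- The `Q` pair-block coefficient tables by block number. -/
noncomputable def l6blkQ : (b : ℕ) → Fin 3 → Fin (l6szP b) → Fin (l6szP b) → ℚ
  | 0 => l6QuuX
  | 1 => l6QmixedX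
  | 2 => l6QddX
  | _ + 3 => fun _ _ _ => 0

/-- **`Γ_j`** (rational, on the 144 ordered-pair codes): the signed scatter-sum of the `Γ` pair blocks' `j`-th coefficient. -/
noncomputable def l6GG (j : Fin 3) : Matrix (Fin 144) (Fin 144) ℚ :=
  ∑ b ∈ Finset.range 3, scatterS (l6szP b) l6LabP l6PosP l6SgnP b (Matrix.of fun a c => l6blkD b j a c)

/-- **`Q_j`** (rational): the signed scatter-sum of the `Q` pair blocks' `j`-th coefficient. -/
noncomputable def l6QQ (j : Fin 3) : Matrix (Fin 144) (Fin 144) ℚ :=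
  ∑ b ∈ Finset.range 3, scatterS (l6szP b) l6LabP l6PosP l6SgnP b (Matrix.of fun a c => l6blkQ b j a c)

/-- The real two-matrix family `Γ(ε) = Σ_j ε^j Γ_j`. -/
noncomputable def l6realGG (ε : ℝ) : Matrix (Fin 144) (Fin 144) ℝ := ∑ j : Fin 3, (ε ^ (j : ℕ)) • (l6GG j).map (Rat.cast : ℚ → ℝ)

/-- The real `Q`-matrix family `Q(ε) = Σ_j ε^j Q_j`. -/
noncomputable def l6realQQ (ε : ℝ) : Matrix (Fin 144) (Fin 144) ℝ := ∑ j : Fin 3, (ε ^ (j : ℕ)) • (l6QQ j).map (Rat.cast : ℚ → ℝ)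

/-! ## §3 Linearity: the real families are the scatter-sums of the real block families -/

/-- Signed scatter is additive in the block. -/
theorem scatterS_add6 {n : Type*} (m : ℕ) (lab pos : n → ℕ) (sgn : n → ℝ) (b : ℕ) (X Y : Matrix (Fin m) (Fin m) ℝ) :
    scatterS m lab pos sgn b (X + Y) = scatterS m lab pos sgn b X + scatterS m lab pos sgn b Y := by
  ext i j
  simp only [scatterS_apply, Matrix.add_apply]
  split_ifs <;> ring

/-- Signed scatter is homogeneous in the block. -/
theorem scatterS_smul6 {n : Type*} (m : ℕ) (lab pos : n → ℕ) (sgn : n → ℝ) (b : ℕ) (c : ℝ) (X : Matrix (Fin m) (Fin m) ℝ) :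
    scatterS m lab pos sgn b (c • X) = c • scatterS m lab pos sgn b X := by
  ext i j
  simp only [scatterS_apply, Matrix.smul_apply, smul_eq_mul]
  split_ifs <;> ring

/-- Signed scatter of a finite sum of blocks. -/
theorem scatterS_sum6 {n : Type*} {ι : Type*} (s : Finset ι) (m : ℕ) (lab pos : n → ℕ) (sgn : n → ℝ) (b : ℕ)
    (X : ι → Matrix (Fin m) (Fin m) ℝ) :
    scatterS m lab pos sgn b (∑ t ∈ s, X t) = ∑ t ∈ s, scatterS m lab pos sgn b (X t) := by
  classical
  induction s using Finset.induction_on with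
  | empty =>
    ext i j; simp only [Finset.sum_empty, scatterS_apply, Matrix.zero_apply]; split_ifs <;> simp
  | insert a s ha ih => rw [Finset.sum_insert ha, Finset.sum_insert ha, scatterS_add6, ih]

/-- The cast of a rational signed scatter is the real signed scatter of the cast block. -/
theorem cast_scatterS6 (m : ℕ) (b : ℕ) (X : Matrix (Fin m) (Fin m) ℚ) (I J : Fin 144) :
    ((scatterS m l6LabP l6PosP l6SgnP b X I J : ℚ) : ℝ) =
      scatterS m l6LabP l6PosP (fun I => (l6SgnP I : ℝ)) b (X.map (Rat.cast : ℚ → ℝ)) I J := by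
  simp only [scatterS_apply]
  split_ifs with h
  · simp only [Rat.cast_mul, Matrix.map_apply]
  · simp

/-- **`Γ(ε)` is the signed scatter-sum of the real `Γ` block families.** -/
theorem l6realGG_eq_sum_scatterS (ε : ℝ) : ∀ I J, l6realGG ε I J =
    ∑ b ∈ Finset.range 3, scatterS (l6szP b) l6LabP l6PosP (fun I => (l6SgnP I : ℝ)) b (realXQ (l6blkD b) ε) I J := by
  intro I J
  have hR : ∀ b, scatterS (l6szP b) l6LabP l6PosP (fun I => (l6SgnP I : ℝ)) b (realXQ (l6blkD b) ε) =
      ∑ j : Fin 3, (ε ^ (j : ℕ)) • scatterS (l6szP b) l6LabP l6PosP (fun I => (l6SgnP I : ℝ)) b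
        ((Matrix.of fun a c => l6blkD b j a c).map (Rat.cast : ℚ → ℝ)) := by
    intro b
    rw [realXQ, scatterS_sum6]
    refine Finset.sum_congr rfl fun j _ => ?_
    rw [scatterS_smul6]
    rfl
  simp_rw [hR]
  simp only [l6realGG, l6GG, Matrix.sum_apply, Matrix.smul_apply, Matrix.map_apply, smul_eq_mul, Rat.cast_sum, cast_scatterS6,
    Finset.mul_sum]
  rw [Finset.sum_comm]

/-- **`Q(ε)` is the signed scatter-sum of the real `Q` block families.** -/
theorem l6realQQ_eq_sum_scatterS (ε : ℝ) : ∀ I J, l6realQQ ε I J =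
    ∑ b ∈ Finset.range 3, scatterS (l6szP b) l6LabP l6PosP (fun I => (l6SgnP I : ℝ)) b (realXQ (l6blkQ b) ε) I J := by
  intro I J
  have hR : ∀ b, scatterS (l6szP b) l6LabP l6PosP (fun I => (l6SgnP I : ℝ)) b (realXQ (l6blkQ b) ε) =
      ∑ j : Fin 3, (ε ^ (j : ℕ)) • scatterS (l6szP b) l6LabP l6PosP (fun I => (l6SgnP I : ℝ)) b
        ((Matrix.of fun a c => l6blkQ b j a c).map (Rat.cast : ℚ → ℝ)) := by
    intro b
    rw [realXQ, scatterS_sum6]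
    refine Finset.sum_congr rfl fun j _ => ?_
    rw [scatterS_smul6]
    rfl
  simp_rw [hR]
  simp only [l6realQQ, l6QQ, Matrix.sum_apply, Matrix.smul_apply, Matrix.map_apply, smul_eq_mul, Rat.cast_sum, cast_scatterS6,
    Finset.mul_sum]
  rw [Finset.sum_comm]

/-! ## §4 Positivity for `0 < ε ≤ 2⁻⁵¹` -/

/-- **LAYER 1 (two-matrix): `Γ(ε) ⪰ 0`** for `0 < ε ≤ 2⁻⁵¹` — the three `Γ` pair-block certificates assembled by the signed scatter-sum. -/
theorem l6realGG_posSemidef {ε : ℝ} (hε0 : 0 < ε) (hε1 : ε ≤ 1 / 2 ^ 51) : (l6realGG ε).PosSemidef := by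
  have hε1' : ε ≤ 1 := hε1.trans (by norm_num)
  refine posSemidef_of_eq_sum_scatterS 3 l6szP l6LabP l6PosP (fun _ I => (l6SgnP I : ℝ)) (fun b => realXQ (l6blkD b) ε)
    (fun b hb => ?_) (l6realGG_eq_sum_scatterS ε)
  interval_cases b
  · refine l6Duu_psd hε0 hε1' ?_
    have h : (1 : ℝ) / 2 ^ 51 * ((l6Duurho1 + l6Duurho2 : ℚ) : ℝ) ≤ (l6Duumu : ℝ) := by norm_num [l6Duurho1, l6Duurho2, l6Duumu]
    have h0 : (0 : ℝ) ≤ ((l6Duurho1 + l6Duurho2 : ℚ) : ℝ) := by norm_num [l6Duurho1, l6Duurho2]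
    nlinarith
  · refine l6Dmixed_psd hε0 hε1' ?_
    have h : (1 : ℝ) / 2 ^ 51 * ((l6Dmixedrho1 + l6Dmixedrho2 : ℚ) : ℝ) ≤ (l6Dmixedmu : ℝ) := by
      norm_num [l6Dmixedrho1, l6Dmixedrho2, l6Dmixedmu]
    have h0 : (0 : ℝ) ≤ ((l6Dmixedrho1 + l6Dmixedrho2 : ℚ) : ℝ) := by norm_num [l6Dmixedrho1, l6Dmixedrho2]
    nlinarith
  · refine l6Ddd_psd hε0 hε1' ?_
    have h : (1 : ℝ) / 2 ^ 51 * ((l6Dddrho1 + l6Dddrho2 : ℚ) : ℝ) ≤ (l6Dddmu : ℝ) := by norm_num [l6Dddrho1, l6Dddrho2, l6Dddmu]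
    have h0 : (0 : ℝ) ≤ ((l6Dddrho1 + l6Dddrho2 : ℚ) : ℝ) := by norm_num [l6Dddrho1, l6Dddrho2]
    nlinarith

/-- **LAYER 1 (`Q`-matrix): `Q(ε) ⪰ 0`** for `0 < ε ≤ 2⁻⁵¹`. -/
theorem l6realQQ_posSemidef {ε : ℝ} (hε0 : 0 < ε) (hε1 : ε ≤ 1 / 2 ^ 51) : (l6realQQ ε).PosSemidef := by
  have hε1' : ε ≤ 1 := hε1.trans (by norm_num)
  refine posSemidef_of_eq_sum_scatterS 3 l6szP l6LabP l6PosP (fun _ I => (l6SgnP I : ℝ)) (fun b => realXQ (l6blkQ b) ε)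
    (fun b hb => ?_) (l6realQQ_eq_sum_scatterS ε)
  interval_cases b
  · refine l6Quu_psd hε0 hε1' ?_
    have h : (1 : ℝ) / 2 ^ 51 * ((l6Quurho1 + l6Quurho2 : ℚ) : ℝ) ≤ (l6Quumu : ℝ) := by norm_num [l6Quurho1, l6Quurho2, l6Quumu]
    have h0 : (0 : ℝ) ≤ ((l6Quurho1 + l6Quurho2 : ℚ) : ℝ) := by norm_num [l6Quurho1, l6Quurho2]
    nlinarith
  · refine l6Qmixed_psd hε0 hε1' ?_
    have h : (1 : ℝ) / 2 ^ 51 * ((l6Qmixedrho1 + l6Qmixedrho2 : ℚ) : ℝ) ≤ (l6Qmixedmu : ℝ) := by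
      norm_num [l6Qmixedrho1, l6Qmixedrho2, l6Qmixedmu]
    have h0 : (0 : ℝ) ≤ ((l6Qmixedrho1 + l6Qmixedrho2 : ℚ) : ℝ) := by norm_num [l6Qmixedrho1, l6Qmixedrho2]
    nlinarith
  · refine l6Qdd_psd hε0 hε1' ?_
    have h : (1 : ℝ) / 2 ^ 51 * ((l6Qddrho1 + l6Qddrho2 : ℚ) : ℝ) ≤ (l6Qddmu : ℝ) := by norm_num [l6Qddrho1, l6Qddrho2, l6Qddmu]
    have h0 : (0 : ℝ) ≤ ((l6Qddrho1 + l6Qddrho2 : ℚ) : ℝ) := by norm_num [l6Qddrho1, l6Qddrho2]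
    nlinarith

end LiftL6

end Summit.Ventures.CertifiedQuantumChemistry
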